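import Literature.AlgebraicGeometry.Motives.AbelianVarietyIsogenyPullbackPushforwardNatural
import Literature.AlgebraicGeometry.Motives.AbelianVarietyIsogenyPushforwardLocallyFreeHolds
import Literature.AlgebraicGeometry.AbelianVarieties.TheoremOfTheSquareCechPic
import Literature.AlgebraicGeometry.AbelianVarieties.LineBundleTensorPower
import Literature.AlgebraicGeometry.Modules.DeterminantCocycleExact
import Literature.AlgebraicGeometry.Modules.DetClassOfIso
import Literature.AlgebraicGeometry.Modules.PullbackFrame
import Literature.AlgebraicGeometry.Modules.LineBundleOfCocycleClass
import Literature.AlgebraicGeometry.KTheory.Determinant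
import Mathlib.CategoryTheory.Limits.Shapes.Biproducts
import Mathlib.Algebra.BigOperators.Group.Finset.Basic
import HarnessLib

/-!
# The norm of a line bundle along a complex isogeny: `g^* det(g_* L) ≅ ⊗_{x ∈ Ker g(ℂ)} t_x^* L`, and
# `L^{⊗|Ker g|}` DESCENDS along `g` when `|Ker g(ℂ)|` is odd (Mumford §7 Thm. 4, §6 Cor. 4 in `Ȟ¹(–, 𝒪^×)`)

Layer `Literature/AlgebraicGeometry/AbelianVarieties`. For an isogeny `g : A → B` of complex abelian varieties with
(finite) kernel `Δ = Ker g(ℂ)` and a vector bundle `F` on `A`, the direct image `g_* F` is a vector bundle on `B`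
(`IsFiniteLocallyFree.pushforward_isogeny`, the tree's PIECE (B)) and `g^* g_* F ≅ ∐_{x ∈ Δ} t_x^* F`
(`nonempty_pullback_pushforward_iso_sigma_of_isAffineLocalizing`, the tree's PIECE (D♮); Mumford §7 Thm. 4 /
§12 Thm. 1). Reading determinant classes in `CechPic = Ȟ¹(–, 𝒪^×)` (`detClass`; `det` is multiplicative on short
exact sequences, `detClass_mul_of_shortExact`) gives the NORM FORMULA

  `g^*[det g_* F] = ∏_{x ∈ Δ} t_x^*[det F]`                          (`pullback_detClass_pushforward_isogeny`),

and, by the theorem of the square in `Ȟ¹` (`TheoremOfTheSquareCechPic`: `t_x^*c = φ_c(x)·c`, `φ_c` a homomorphism),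
`∏_{x ∈ Δ} t_x^*c = c^{|Δ|} · φ_c(∏_{x ∈ Δ} x)`; when `|Δ|` is ODD the product of all elements of the abelian group
`Δ` is `1` (`prod_univ_eq_one_of_odd_card`), so

  `g^*[det g_* F] = [det F]^{|Δ|}`                                    (`pullback_detClass_pushforward_isogeny_of_odd`):

the `|Δ|`-th tensor power of a LINE bundle `L` on `A` is the pull-back of the line bundle `isogenyNorm g L` on `B`
with class `[det g_* L]` — `L^{⊗|Δ|} ≅ g^*(isogenyNorm g L)` (`nonempty_tensorPow_iso_pullback_isogenyNorm`) — an
EXPLICIT descent, no linearisation and no theta group. (For `|Δ|` even the product of the elements of `Δ` is the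
product of its elements of order `2` and the correction `φ_{[L]}(∏ x)` is a genuine `2`-torsion class.)

* §1 (generic `Modules`): `isFiniteLocallyFree_biproduct'`, **`detClass_biproduct`** (`[det ⨁_j E_j] = ∏_j [det E_j]`,
  by induction along the split sequences `0 → E_i → ⨁_j E_j → ⨁_{j ≠ i} E_j → 0` — the Literature-side copy of the
  `K₀` engine of `Summits/…/VHCAbelianSchemesRoadIsogenyPushforwardChernCharacter`, which a Literature file cannot
  import), `detClass_eq_prod_of_iso_sigmaObj`.
* §2 (groups): `prod_univ_eq_one_of_odd_card` — in a finite commutative group of odd order the product of all the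
  elements is `1` (pair `x` with `x⁻¹`; `Finset.prod_involution`).
* §3 (abelian varieties, any field): `prod_pullback_translation_eq` — `∏_i t_{x_i}^*c = c^n · φ_c(∏_i x_i)`.
* §4 (complex isogenies): `pullback_detClass_pushforward_isogeny`, `…_of_odd`; the module `isogenyNorm g hg F hF`
  (the line bundle of the cocycle `detCocycle (g_* F)`; `detClass_isogenyNorm`, `hasRank_isogenyNorm`), and
  **`nonempty_tensorPow_iso_pullback_isogenyNorm`**: `L^{⊗|Ker g(ℂ)|} ≅ g^*(isogenyNorm g L)` for `|Ker g(ℂ)|` odd.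

Everything is proved; 0 named facts; the one `def` is a construction with body; no instance, no notation. Typed for
the cell `pub-hodge-ring2` (plate (K1′) of crux 26512: the ample part `pr_a^*Θ^{⊗2(d+1)}` of Markman's kernel descends
along the cyclic quotient `A → A/G₁`, `|G₁| = d+1` odd); a research route conditional on HC_CM, not a corollary —
nothing in this file refers to it.

## References

* [MumfordAV1970] D. Mumford, *Abelian Varieties* (1970), §6 Cor. 4 (p. 59) (theorem of the square), §7 Thm. 4
  (p. 72) and §12 Thm. 1 (p. 112) (`π^*π_* F ≅ ⊕_{x ∈ K} T_x^* F`), §23 (descent of line bundles to `X/K`).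
* [Hartshorne1977] R. Hartshorne, *Algebraic Geometry* (1977), II Ex. 6.11 (`det : K(X) → Pic X`), II Ex. 5.16 (d).
* [Lange2023AbelianVarietiesC] H. Lange, *Abelian Varieties over the Complex Numbers* (2023), Thm. 1.3.5, §1.4.2.
* [Fulton1998] W. Fulton, *Intersection theory*, 2nd ed. (1998), §15.1, Example 3.2.3.
-/

noncomputable section

-- `TopCat.Presheaf`/`Scheme.Modules` are not reducible (as in Mathlib's `AlgebraicGeometry/Modules/Sheaf.lean`).
set_option backward.isDefEq.respectTransparency false

open CategoryTheory CategoryTheory.Limits AlgebraicGeometry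

universe u

/-! ### §1 The determinant class of a finite direct sum -/

namespace Literature.AlgebraicGeometry.Modules

open Literature.AlgebraicGeometry.Motives Literature.AlgebraicGeometry.KTheory

variable {X : Scheme.{u}} [HasFiniteBiproducts X.Modules]

/-- The split short exact sequence `0 → E_i → ⨁_j E_j → ⨁_{j ≠ i} E_j → 0` of a finite biproduct (Mathlib's
`biproduct.isColimitToSubtype`). [cite: Fulton1998, §15.1 (definition of K°X)] -/
theorem shortExact_biproduct_ι_toSubtype' {J : Type} [Finite J] (f : J → X.Modules) (i : J) :
    (ShortComplex.mk (biproduct.ι f i) (biproduct.toSubtype f fun j => j ≠ i)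
      (by classical
          rw [biproduct.ι_toSubtype, dif_neg (not_not.mpr rfl)])).ShortExact where
  exact := ShortComplex.exact_of_g_is_cokernel _ (biproduct.isColimitToSubtype f i)
  mono_f := by dsimp; infer_instance
  epi_g := by
    dsimp
    exact epi_of_epi_fac (biproduct.fromSubtype_toSubtype f _)

/-- Induction engine: a finite biproduct of vector bundles is a vector bundle. [cite: Fulton1998, §15.1 (definition of K°X)] -/
private theorem isFiniteLocallyFree_biproduct_aux' : ∀ (n : ℕ) {J : Type} [Fintype J] (f : J → X.Modules),
    Fintype.card J = n → (∀ j, IsFiniteLocallyFree (f j)) → IsFiniteLocallyFree (⨁ f)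
  | 0, J, _, f, hJ, hf => by
    haveI : IsEmpty J := Fintype.card_eq_zero_iff.mp hJ
    refine KZero.isFiniteLocallyFree_of_isZero ?_
    rw [IsZero.iff_id_eq_zero]
    exact biproduct.hom_ext _ _ fun j => isEmptyElim j
  | n + 1, J, _, f, hJ, hf => by
    classical
    haveI : Nonempty J := Fintype.card_pos_iff.mp (by omega)
    obtain ⟨i⟩ := ‹Nonempty J›
    have hcard : Fintype.card {j // j ≠ i} = n := by
      rw [Fintype.card_subtype_compl, Fintype.card_subtype_eq, hJ]; omega
    exact isFiniteLocallyFree_of_shortExact (shortExact_biproduct_ι_toSubtype' f i) (hf i)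
      (isFiniteLocallyFree_biproduct_aux' n (Subtype.restrict (fun j => j ≠ i) f) hcard fun j => hf j.1)

/-- **A finite direct sum of vector bundles is a vector bundle** (Literature-side copy, for `detClass_biproduct`).
[cite: Fulton1998, §15.1 (definition of K°X)] -/
theorem isFiniteLocallyFree_biproduct' {J : Type} [Fintype J] (f : J → X.Modules)
    (hf : ∀ j, IsFiniteLocallyFree (f j)) : IsFiniteLocallyFree (⨁ f) :=
  isFiniteLocallyFree_biproduct_aux' (Fintype.card J) f rfl hf

/-- Induction engine for `detClass_biproduct`. [cite: Hartshorne1977, II Ex. 6.11] -/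
private theorem detClass_biproduct_aux : ∀ (n : ℕ) {J : Type} [Fintype J] (f : J → X.Modules),
    Fintype.card J = n → ∀ (hf : ∀ j, IsFiniteLocallyFree (f j)) (h : IsFiniteLocallyFree (⨁ f)),
      detClass h = ∏ j, detClass (hf j)
  | 0, J, _, f, hJ, hf, h => by
    haveI : IsEmpty J := Fintype.card_eq_zero_iff.mp hJ
    rw [Fintype.prod_empty]
    have h0 : IsZero (⨁ f) := by
      rw [IsZero.iff_id_eq_zero]
      exact biproduct.hom_ext _ _ fun j => isEmptyElim j
    -- the determinant class factors through `K₀`, where a zero bundle vanishes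
    have hdet := KZero.det_of (⨁ f) h
    rw [KZero.of_isZero h0 h, map_zero] at hdet
    exact (ofMul_eq_zero.mp hdet.symm)
  | n + 1, J, _, f, hJ, hf, h => by
    classical
    haveI : Nonempty J := Fintype.card_pos_iff.mp (by omega)
    obtain ⟨i⟩ := ‹Nonempty J›
    have hcard : Fintype.card {j // j ≠ i} = n := by
      rw [Fintype.card_subtype_compl, Fintype.card_subtype_eq, hJ]; omega
    have hrest : IsFiniteLocallyFree (⨁ Subtype.restrict (fun j => j ≠ i) f) :=
      isFiniteLocallyFree_biproduct' _ fun j => hf j.1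
    rw [detClass_mul_of_shortExact (shortExact_biproduct_ι_toSubtype' f i) (hf i) h hrest,
      detClass_biproduct_aux n (Subtype.restrict (fun j => j ≠ i) f) hcard (fun j => hf j.1) hrest]
    change detClass (hf i) * ∏ j : {j // j ≠ i}, detClass (hf j.1) = _
    rw [← Finset.prod_subtype (Finset.univ.erase i) (p := fun j => j ≠ i)
        (fun j => by rw [Finset.mem_erase]; simp) (f := fun j => detClass (hf j))]
    exact Finset.mul_prod_erase Finset.univ (fun j => detClass (hf j)) (Finset.mem_univ i)

/-- **`[det ⨁_j E_j] = ∏_j [det E_j]` in `Ȟ¹(X, 𝒪_X^×)`** for vector bundles `E_j` (Hartshorne II Ex. 6.11: `det` is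
additive on `K(X)`; here by induction along the split sequences of the biproduct). [cite: Hartshorne1977, II Ex. 6.11] -/
theorem detClass_biproduct {J : Type} [Fintype J] (f : J → X.Modules) (hf : ∀ j, IsFiniteLocallyFree (f j))
    (h : IsFiniteLocallyFree (⨁ f)) : detClass h = ∏ j, detClass (hf j) :=
  detClass_biproduct_aux (Fintype.card J) f rfl hf h

/-- **`[det E] = ∏_j [det E_j]` for `E ≅ ∐_j E_j`** a finite coproduct of vector bundles (the coproduct is the
biproduct, `biproduct.isoCoproduct`; `detClass_eq_of_iso`). [cite: Hartshorne1977, II Ex. 6.11] -/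
theorem detClass_eq_prod_of_iso_sigmaObj {J : Type} [Fintype J] (f : J → X.Modules) (hf : ∀ j, IsFiniteLocallyFree (f j))
    {E : X.Modules} (hE : IsFiniteLocallyFree E) (e : E ≅ ∐ f) : detClass hE = ∏ j, detClass (hf j) := by
  have h := isFiniteLocallyFree_biproduct' f hf
  rw [detClass_eq_of_iso (e ≪≫ (biproduct.isoCoproduct f).symm) hE h, detClass_biproduct f hf h]

end Literature.AlgebraicGeometry.Modules

/-! ### §2 The product of all elements of a finite commutative group of odd order -/

section OddOrder

/-- **In a finite commutative group of odd order the product of all the elements is `1`**: `x ↦ x⁻¹` is an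
involution of `G` without fixed points other than `1` (an element with `x = x⁻¹` has order dividing `2` and `|G|`,
hence order `1`), so the factors pair off (`Finset.prod_involution`). (For even order the product is the product
of the elements of order `2`.) [cite: MumfordAV1970, §23 (descent of line bundles to X/K)] -/
theorem prod_univ_eq_one_of_odd_card {G : Type*} [CommGroup G] [Fintype G] (hodd : Odd (Fintype.card G)) :
    ∏ x : G, x = 1 := by
  classical
  refine Finset.prod_involution (fun x _ => x⁻¹) (fun x _ => mul_inv_cancel x) (fun x _ hx h => hx ?_)
    (fun x _ => Finset.mem_univ _) (fun x _ => inv_inv x)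
  -- `x⁻¹ = x` forces `x = 1` in a group of odd order
  have h2 : x ^ 2 = 1 := by
    rw [pow_two]
    nth_rewrite 2 [← h]
    exact mul_inv_cancel x
  have hord : orderOf x ∣ 2 := orderOf_dvd_of_pow_eq_one h2
  have hcard : orderOf x ∣ Fintype.card G := orderOf_dvd_card
  have hodd' : Odd (orderOf x) := hodd.of_dvd_nat hcard
  have h1 : orderOf x = 1 := by
    rcases (Nat.dvd_prime Nat.prime_two).mp hord with h | h
    · exact h
    · exact absurd (h ▸ hodd') (by decide)
  exact orderOf_eq_one_iff.mp h1

/-- The same for the elements of a finite subgroup of odd order of a commutative group, read in the ambient group.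
[cite: MumfordAV1970, §23 (descent of line bundles to X/K)] -/
theorem prod_univ_coe_eq_one_of_odd_card {G : Type*} [CommGroup G] (H : Subgroup G) [Fintype H]
    (hodd : Odd (Fintype.card H)) : ∏ x : H, (x : G) = 1 := by
  have h := congrArg H.subtype (prod_univ_eq_one_of_odd_card hodd)
  rw [map_prod, map_one] at h
  exact h

end OddOrder

/-! ### §3 Products of translates of a class: `∏_i t_{x_i}^*c = c^n · φ_c(∏_i x_i)` -/

namespace Literature.AlgebraicGeometry.AbelianVarieties

open Literature.AlgebraicGeometry.Motives Literature.AlgebraicGeometry.Motives.AbelianVariety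
open Literature.AlgebraicGeometry.Modules

section Translates

variable {K : Type u} [Field K] (A : AbelianVariety K)

/-- **`∏_i t_{x_i}^*c = c^n · φ_c(∏_i x_i)`** for a class `c ∈ Ȟ¹(A, 𝒪_A^×)` and finitely many rational points
`x_i` (`t_x^*c = φ_c(x)·c` and `φ_c` is a homomorphism — the theorem of the square, `phiPic_mul'`).
[cite: Lange2023AbelianVarietiesC, Thm. 1.3.5 and §1.4.2] [cite: MumfordAV1970, §6 Cor. 4 (p. 59)] -/
theorem prod_pullback_translation_eq {ι : Type*} [Fintype ι] (c : CechPic A.X.left) (x : ι → A.Points K) :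
    ∏ i, CechPic.pullback (A.translation (x i)).left c = c ^ Fintype.card ι * phiPic A c (∏ i, x i) := by
  classical
  have h : ∏ i, phiPic A c (x i) = phiPic A c (∏ i, x i) := by
    simpa only [phiPicHom_apply] using (map_prod (phiPicHom A A.theoremOfTheSquare_holds c) x Finset.univ).symm
  simp_rw [pullback_translation_eq_phiPic_mul]
  rw [Finset.prod_mul_distrib, Finset.prod_const, Finset.card_univ, h, mul_comm]

/-- **`∏_i t_{x_i}^*c = c^n` when `∏_i x_i = 1`** (in particular over all elements of a finite subgroup of odd order,
`prod_univ_coe_eq_one_of_odd_card`). [cite: Lange2023AbelianVarietiesC, Thm. 1.3.5 and §1.4.2] -/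
theorem prod_pullback_translation_eq_pow {ι : Type*} [Fintype ι] (c : CechPic A.X.left) (x : ι → A.Points K)
    (hx : ∏ i, x i = 1) : ∏ i, CechPic.pullback (A.translation (x i)).left c = c ^ Fintype.card ι := by
  rw [prod_pullback_translation_eq, hx, phiPic_one, mul_one]

end Translates

/-! ### §4 The norm along a complex isogeny -/

section Norm

variable {A B : AbelianVariety ℂ} (g : A ⟶ B) (hg : IsIsogeny g) (F : A.X.left.Modules) (hF : IsFiniteLocallyFree F)
variable [Fintype ↥(Hom.kerPoints (specOver ℂ ℂ) g)]

/-- **`[det g^*g_* F] = ∏_{x ∈ Ker g(ℂ)} [det t_x^* F]`** for a vector bundle `F` on `A` and a complex isogeny `g`: the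
tree's decomposition `g^* g_* F ≅ ∐_x t_x^* F` read in `Ȟ¹(A, 𝒪_A^×)`. [cite: MumfordAV1970, §7 Thm. 4 (p. 72) and §12 Thm. 1 (p. 112)] -/
theorem detClass_pullback_pushforward_isogeny :
    detClass ((hF.pushforward_isogeny hg).pullback (Hom.toSchemeHom g)) =
      ∏ x : Hom.kerPoints (specOver ℂ ℂ) g, detClass (hF.pullback (A.translation (x : A.Points ℂ)).left) := by
  letI : HasFiniteBiproducts A.X.left.Modules := HasFiniteBiproducts.of_hasFiniteProducts
  haveI := hF.isVectorBundle.1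
  obtain ⟨e⟩ := nonempty_pullback_pushforward_iso_sigma_of_isAffineLocalizing g hg F (IsAffineLocalizing.of_isQuasicoherent F)
  exact detClass_eq_prod_of_iso_sigmaObj _
    (fun x : Hom.kerPoints (specOver ℂ ℂ) g => hF.pullback (A.translation (x : A.Points ℂ)).left) _ e

/-- **THE NORM FORMULA `g^*[det g_* F] = ∏_{x ∈ Ker g(ℂ)} t_x^*[det F]`** (`det` commutes with pull-back,
`detClass_pullback`). [cite: MumfordAV1970, §7 Thm. 4 (p. 72) and §12 Thm. 1 (p. 112)] [cite: Hartshorne1977, II Ex. 6.11] -/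
theorem pullback_detClass_pushforward_isogeny :
    CechPic.pullback (Hom.toSchemeHom g) (detClass (hF.pushforward_isogeny hg)) =
      ∏ x : Hom.kerPoints (specOver ℂ ℂ) g, CechPic.pullback (A.translation (x : A.Points ℂ)).left (detClass hF) := by
  rw [← detClass_pullback, detClass_pullback_pushforward_isogeny g hg F hF]
  exact Finset.prod_congr rfl fun x _ => detClass_pullback _ hF

/-- **`g^*[det g_* F] = [det F]^{|Ker g(ℂ)|}` when `|Ker g(ℂ)|` is ODD** (the translates multiply to
`[det F]^{|Ker|} · φ(∏ x)` and the product of the elements of a group of odd order is `1`).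
[cite: MumfordAV1970, §6 Cor. 4 (p. 59), §7 Thm. 4 (p. 72) and §23] -/
theorem pullback_detClass_pushforward_isogeny_of_odd (hodd : Odd (Fintype.card ↥(Hom.kerPoints (specOver ℂ ℂ) g))) :
    CechPic.pullback (Hom.toSchemeHom g) (detClass (hF.pushforward_isogeny hg)) =
      detClass hF ^ Fintype.card ↥(Hom.kerPoints (specOver ℂ ℂ) g) := by
  rw [pullback_detClass_pushforward_isogeny g hg F hF]
  exact prod_pullback_translation_eq_pow A (detClass hF) (fun x : Hom.kerPoints (specOver ℂ ℂ) g => (x : A.Points ℂ))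
    (prod_univ_coe_eq_one_of_odd_card _ hodd)

/-- **The norm of a vector bundle along an isogeny**: a LINE bundle on `B` with class `[det g_* F]` (the glued line
bundle of the determinant cocycle of the vector bundle `g_* F`). For a line bundle `L` this is `N_g(L) = det g_* L`,
whose pull-back is `⊗_{x ∈ Ker g} t_x^* L`. [cite: MumfordAV1970, §7 Thm. 4 (p. 72) and §23] [cite: Hartshorne1977, II Ex. 6.11] -/
def isogenyNorm : B.X.left.Modules :=
  lineBundle (detCocycle (hF.pushforward_isogeny hg))

omit [Fintype ↥(Hom.kerPoints (specOver ℂ ℂ) g)] in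
/-- The norm is finite locally free. [cite: Hartshorne1977, II Ex. 6.11] -/
theorem isFiniteLocallyFree_isogenyNorm : IsFiniteLocallyFree (isogenyNorm g hg F hF) :=
  (detCocycle (hF.pushforward_isogeny hg)).isFiniteLocallyFree_lineBundle

omit [Fintype ↥(Hom.kerPoints (specOver ℂ ℂ) g)] in
/-- The norm has rank one. [cite: Hartshorne1977, II Ex. 6.11] -/
theorem hasRank_isogenyNorm : HasRank (isogenyNorm g hg F hF) 1 :=
  (detCocycle (hF.pushforward_isogeny hg)).hasRank_lineBundle

omit [Fintype ↥(Hom.kerPoints (specOver ℂ ℂ) g)] in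
/-- `[isogenyNorm g F] = [det g_* F]`. [cite: Hartshorne1977, II Ex. 6.11] -/
theorem detClass_isogenyNorm (h : IsFiniteLocallyFree (isogenyNorm g hg F hF)) :
    detClass h = detClass (hF.pushforward_isogeny hg) :=
  (detClass_congr h (isFiniteLocallyFree_isogenyNorm g hg F hF)).trans
    (UnitCocycle.detClass_lineBundle (c := detCocycle (hF.pushforward_isogeny hg)))

/-- **`g^*[isogenyNorm g F] = [det F]^{|Ker g(ℂ)|}` for `|Ker g(ℂ)|` odd.** [cite: MumfordAV1970, §7 Thm. 4 (p. 72) and §23] -/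
theorem pullback_detClass_isogenyNorm_of_odd (hodd : Odd (Fintype.card ↥(Hom.kerPoints (specOver ℂ ℂ) g)))
    (h : IsFiniteLocallyFree (isogenyNorm g hg F hF)) :
    CechPic.pullback (Hom.toSchemeHom g) (detClass h) = detClass hF ^ Fintype.card ↥(Hom.kerPoints (specOver ℂ ℂ) g) := by
  rw [detClass_isogenyNorm, pullback_detClass_pushforward_isogeny_of_odd g hg F hF hodd]

/-- **EXPLICIT DESCENT OF `L^{⊗|Ker g|}` ALONG AN ISOGENY WITH KERNEL OF ODD ORDER: `L^{⊗|Ker g(ℂ)|} ≅ g^*(isogenyNorm g L)`**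
for a line bundle `L` on `A` (rank-one modules are classified by their class, `nonempty_iso_iff_detClass_eq`;
`[L^{⊗m}] = [L]^m`, `detClass_tensorPow`). No linearisation is chosen: the descended bundle is `det g_* L`.
[cite: MumfordAV1970, §7 Thm. 4 (p. 72), §12 Thm. 1 (p. 112) and §23] -/
theorem nonempty_tensorPow_iso_pullback_isogenyNorm (h₁ : HasRank F 1) {m : ℕ}
    (hm : Fintype.card ↥(Hom.kerPoints (specOver ℂ ℂ) g) = m) (hodd : Odd m) :
    Nonempty (tensorPow F m ≅ (Scheme.Modules.pullback (Hom.toSchemeHom g)).obj (isogenyNorm g hg F hF)) := by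
  have hN := isFiniteLocallyFree_isogenyNorm g hg F hF
  refine (nonempty_iso_iff_detClass_eq (hasRank_tensorPow_one h₁ m) (hasRank_pullback _ (hasRank_isogenyNorm g hg F hF))
    (isFiniteLocallyFree_tensorPow hF m) (hN.pullback _)).2 ?_
  rw [detClass_tensorPow h₁ hF, detClass_pullback _ hN, pullback_detClass_isogenyNorm_of_odd g hg F hF (hm ▸ hodd), hm]

end Norm

end Literature.AlgebraicGeometry.AbelianVarieties

end
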